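import Summits.Schanuel.Schanuel.Theorems.RootDecomp1KTHLayerCell02

/-!
# RootDecomp1KTHLayerCell — lens 1, generation 40 «THE (T.H.) LAYER OF 33364: ORDER GRADING + LIOUVILLE TRANSCENDENCE-TYPE MEASURE + DIAZ RUNGS ON THE MOMENT CURVE» — continuation (RootDecomp1KTHLayerCell03): §4 (T.H.), freeness and the Liouville binders for the power tuples of `ℓ_b`; the named cell and the moment curves in the (T.H.)-layer scope

(lens-1 g40 `RootDecomp1KTHLayerCell.lean` [HOME/decomp-schanuel-lens-1/g40/ sha256 b5224e65…a9df, 1031 l; NODE L1861 / REQUEST L1862; critic VERDICT L1866 (CLEARED, ONE THEOREM credit, RULE K-R27, port GO)]; port by census-1 gen 17 as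
`RootDecomp1KTHLayerCell01`–`04` — see the PORT NOTE of part 01; `--supports stmt-Schanuel-33364`; rung 0.)
-/

noncomputable section

open Complex Polynomial IntermediateField Filter Asymptotics LiouvilleNumber
open scoped Nat Topology

namespace Summit.Schanuel.Schanuel.Theorems.RootDecomp1KTHLayer

open Summit.Schanuel.Schanuel.Theorems.RootDecomp1KHyper
open Summit.Schanuel.Schanuel.Theorems.RootDecomp1KHyper.HyperCell
open Summit.Schanuel.Schanuel.Theorems.RootDecomp1KGeneric (not_technicalHypothesis_of_hyperLinLiouville LiouvilleOrder)
open Summit.Schanuel.Schanuel.Theorems.RootDecomp1KFiniteOrderCell (zF ellF liouvilleOrder_ellF ellF_pos ellF_le_one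
  linearIndependent_zF linLiouville_zF not_hyperLinLiouville_zF zF_in_scope_33364)
open Summit.Schanuel.Schanuel.Theorems.RootDecomp1KTwoBaseCell (liouvilleNumber_le partialSum_pos')
open Literature.Barriers.Schanuel (TechnicalHypothesis LargeTranscendenceDegree gridField gridField₂ gridExp
  trdeg_mono one_le_of_add_lt_mul)

/-! ## §4 (T.H.), freeness and the Liouville binders for the power tuples of `ℓ_b` -/

section Powers

variable {b : ℕ}

/-- The power tuple `(ℓ_b^{e i})_i`. -/
def zpow (b : ℕ) {n : ℕ} (e : Fin n → ℕ) : Fin n → ℂ :=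
  fun i => ((liouvilleNumber (b : ℝ) : ℝ) : ℂ) ^ e i

/-- **The Liouville moment curve** `zC b n = (ℓ_b, ℓ_b², …, ℓ_bⁿ)` (tree convention, cf.
`linLiouville_momentCurve`; `zC b 2` is 33364's named first open cell `(ℓ_b, ℓ_b²)`). -/
def zC (b n : ℕ) : Fin n → ℂ := fun i => ((liouvilleNumber (b : ℝ) : ℝ) : ℂ) ^ ((i : ℕ) + 1)

/-- The power tuple with constant `zK b l = (1, ℓ_b, …, ℓ_b^{l−1})` (second factor of the grid). -/
def zK (b l : ℕ) : Fin l → ℂ := fun j => ((liouvilleNumber (b : ℝ) : ℝ) : ℂ) ^ (j : ℕ)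

/-- The moment curve `zC b n` is the power tuple with exponents `1, …, n`. -/
theorem zC_eq_zpow (b n : ℕ) : zC b n = zpow b (fun i : Fin n => (i : ℕ) + 1) := rfl

/-- The tuple `zK b l` is the power tuple with exponents `0, …, l-1`. -/
theorem zK_eq_zpow (b l : ℕ) : zK b l = zpow b (fun j : Fin l => (j : ℕ)) := rfl

/-- `ℓ_b` is transcendental (as a complex number). -/
theorem transcendental_ell (hb : 2 ≤ b) : Transcendental ℚ ((liouvilleNumber (b : ℝ) : ℝ) : ℂ) :=
  transcendental_ofReal_of_liouville (liouville_liouvilleNumber hb)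

/-- Distinct powers of a transcendental number are ℚ-linearly independent. -/
theorem linearIndependent_pow_of_transcendental {x : ℂ} (hx : Transcendental ℚ x) {n : ℕ}
    {e : Fin n → ℕ} (he : Function.Injective e) : LinearIndependent ℚ (fun i => x ^ e i) := by
  rw [Fintype.linearIndependent_iff]
  intro c hc i
  set f : ℚ[X] := ∑ j, Polynomial.monomial (e j) (c j) with hf
  have hfx : aeval x f = 0 := by
    rw [hf, map_sum]
    simp only [aeval_monomial]
    rw [← hc]
    exact Finset.sum_congr rfl fun j _ => by rw [Algebra.smul_def]
  have hf0 : f = 0 := by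
    by_contra hne
    exact hx ⟨f, hne, hfx⟩
  have hcoeff : f.coeff (e i) = c i := by
    rw [hf, finsetSum_coeff]
    simp only [coeff_monomial]
    rw [Finset.sum_eq_single i]
    · simp
    · intro j _ hji
      rw [if_neg]
      exact fun h => hji (he h)
    · intro h; exact absurd (Finset.mem_univ i) h
  rw [hf0, coeff_zero] at hcoeff
  exact hcoeff.symm

/-- Freeness of the power tuples of `ℓ_b`. -/
theorem linearIndependent_zpow (hb : 2 ≤ b) {n : ℕ} {e : Fin n → ℕ} (he : Function.Injective e) :
    LinearIndependent ℚ (zpow b e) :=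
  linearIndependent_pow_of_transcendental (transcendental_ell hb) he

/-- The integer polynomial `Σ hᵢ X^{eᵢ}` of a relation. -/
def relPoly {n : ℕ} (e : Fin n → ℕ) (h : Fin n → ℤ) : ℤ[X] := ∑ i, Polynomial.monomial (e i) (h i)

/-- Coefficients of `relPoly e h`: the `j`-th coefficient collects the `h i` with `e i = j`. -/
theorem relPoly_coeff {n : ℕ} (e : Fin n → ℕ) (h : Fin n → ℤ) (j : ℕ) :
    (relPoly e h).coeff j = ∑ i, if e i = j then h i else 0 := by
  rw [relPoly, finsetSum_coeff]
  simp only [coeff_monomial]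

/-- `relPoly e h ≠ 0` for injective exponents `e` and `h ≠ 0`. -/
theorem relPoly_ne_zero {n : ℕ} {e : Fin n → ℕ} (he : Function.Injective e) {h : Fin n → ℤ}
    (hh : h ≠ 0) : relPoly e h ≠ 0 := by
  obtain ⟨i, hi⟩ : ∃ i, h i ≠ 0 := Function.ne_iff.mp hh
  intro h0
  have hc : (relPoly e h).coeff (e i) = h i := by
    rw [relPoly_coeff, Finset.sum_eq_single i]
    · simp
    · intro j _ hji
      rw [if_neg]
      exact fun h' => hji (he h')
    · intro h'; exact absurd (Finset.mem_univ i) h'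
  rw [h0, coeff_zero] at hc
  exact hi hc.symm

/-- `natDegree (relPoly e h) ≤ D` when all exponents are `≤ D`. -/
theorem relPoly_natDegree_le {n : ℕ} (e : Fin n → ℕ) (h : Fin n → ℤ) {D : ℕ} (hD : ∀ i, e i ≤ D) :
    (relPoly e h).natDegree ≤ D := by
  rw [relPoly]
  exact natDegree_sum_le_of_forall_le _ _ fun i _ => (natDegree_monomial_le _).trans (hD i)

/-- Height of `relPoly e h`: every coefficient is bounded by `Σ |h i|`. -/
theorem relPoly_coeff_abs_le {n : ℕ} (e : Fin n → ℕ) (h : Fin n → ℤ) (j : ℕ) :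
    |(((relPoly e h).coeff j : ℤ) : ℝ)| ≤ ∑ i, |(h i : ℝ)| := by
  rw [relPoly_coeff, Int.cast_sum]
  refine (Finset.abs_sum_le_sum_abs _ _).trans (Finset.sum_le_sum fun i _ => ?_)
  split_ifs <;> simp

/-- Evaluation of `relPoly e h` at a real point is the form `Σ h i · x^{e i}`. -/
theorem relPoly_eval {n : ℕ} (e : Fin n → ℕ) (h : Fin n → ℤ) (x : ℝ) :
    ((relPoly e h).map (algebraMap ℤ ℝ)).eval x = ∑ i, (h i : ℝ) * x ^ e i := by
  rw [eval_map, relPoly, eval₂_finsetSum]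
  simp [eval₂_monomial]

/-- The complex form of a relation on `zpow b e` is the real number `Σ hᵢ ℓ_b^{eᵢ}`. -/
theorem form_zpow_eq {n : ℕ} (e : Fin n → ℕ) (h : Fin n → ℤ) :
    ∑ i, (h i : ℂ) * zpow b e i = ((∑ i, (h i : ℝ) * (liouvilleNumber (b : ℝ)) ^ e i : ℝ) : ℂ) := by
  simp only [zpow]
  norm_cast

/-- **The measure, relation form:** `|Σ hᵢ ℓ_b^{eᵢ}| ≥ exp(−C (log(3 + Σ|hᵢ|))^{D+2})` for all nonzero
`h ∈ ℤⁿ` (`e` injective, `eᵢ ≤ D`). -/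
theorem form_zpow_lower (hb : 2 ≤ b) {n : ℕ} {e : Fin n → ℕ} (he : Function.Injective e) {D : ℕ}
    (hD : ∀ i, e i ≤ D) :
    ∃ C : ℝ, 0 < C ∧ ∀ h : Fin n → ℤ, h ≠ 0 →
      Real.exp (-(C * Real.log (3 + ∑ i, |(h i : ℝ)|) ^ (D + 2))) ≤ ‖∑ i, (h i : ℂ) * zpow b e i‖ := by
  obtain ⟨C, hC, hm⟩ := measure_logPow hb D
  refine ⟨C, hC, fun h hh => ?_⟩
  have hS0 : 0 ≤ ∑ i, |(h i : ℝ)| := Finset.sum_nonneg fun i _ => abs_nonneg _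
  have h1 := hm (relPoly e h) (relPoly_ne_zero he hh) (relPoly_natDegree_le e h hD)
    (3 + ∑ i, |(h i : ℝ)|) (by linarith)
    (fun j => (relPoly_coeff_abs_le e h j).trans (by linarith))
  rw [relPoly_eval] at h1
  rw [form_zpow_eq, Complex.norm_real, Real.norm_eq_abs]
  exact h1

/-- **(T.H.) FOR THE POWER TUPLES OF A LIOUVILLE NUMBER** — hypothesis-free: every tuple of distinct powers
`(ℓ_b^{e i})_i` satisfies Diaz's technical hypothesis. -/
theorem technicalHypothesis_zpow (hb : 2 ≤ b) {n : ℕ} {e : Fin n → ℕ} (he : Function.Injective e) :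
    TechnicalHypothesis (zpow b e) := by
  obtain ⟨C, hC, hm⟩ := form_zpow_lower hb he (D := Finset.univ.sup e) fun i => Finset.le_sup (Finset.mem_univ i)
  exact technicalHypothesis_of_logPow hC.le hm

/-- (T.H.) and freeness of the moment curve `zC b n`. -/
theorem technicalHypothesis_zC (hb : 2 ≤ b) (n : ℕ) : TechnicalHypothesis (zC b n) := by
  rw [zC_eq_zpow]; exact technicalHypothesis_zpow hb fun i j hij => Fin.ext (by simpa using hij)

/-- The moment curve `zC b n` is ℚ-linearly independent (`b ≥ 2`). -/
theorem linearIndependent_zC (hb : 2 ≤ b) (n : ℕ) : LinearIndependent ℚ (zC b n) := by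
  rw [zC_eq_zpow]; exact linearIndependent_zpow hb fun i j hij => Fin.ext (by simpa using hij)

/-- (T.H.) and freeness of `zK b l = (1, ℓ_b, …, ℓ_b^{l−1})`. -/
theorem technicalHypothesis_zK (hb : 2 ≤ b) (l : ℕ) : TechnicalHypothesis (zK b l) := by
  rw [zK_eq_zpow]; exact technicalHypothesis_zpow hb fun i j hij => Fin.ext hij

/-- The tuple `zK b l` is ℚ-linearly independent (`b ≥ 2`). -/
theorem linearIndependent_zK (hb : 2 ≤ b) (l : ℕ) : LinearIndependent ℚ (zK b l) := by
  rw [zK_eq_zpow]; exact linearIndependent_zpow hb fun i j hij => Fin.ext hij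

/-- **(T.H.) at 33364's NAMED first open cell `(ℓ_b, ℓ_b²)`** (the cell of `liouvilleNumber_sq_cell`). -/
theorem technicalHypothesis_liouvilleNumber_sq (hb : 2 ≤ b) :
    TechnicalHypothesis ![((liouvilleNumber b : ℝ) : ℂ), ((liouvilleNumber b : ℝ) : ℂ) ^ 2] := by
  have h : zC b 2 = ![((liouvilleNumber b : ℝ) : ℂ), ((liouvilleNumber b : ℝ) : ℂ) ^ 2] := by
    funext i; fin_cases i <;> simp [zC]
  rw [← h]; exact technicalHypothesis_zC hb 2

/-- **33364's NAMED first open cell `(ℓ_b, ℓ_b²)` lies in the scope of the layer `F₀`** (tree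
`liouvilleNumber_sq_cell`: ℚ-free, `LinLiouville`, `¬HyperLinLiouville`; new: (T.H.)). -/
theorem namedCell_mem_thLayer_scope (hb : 2 ≤ b) :
    LinearIndependent ℚ ![((liouvilleNumber b : ℝ) : ℂ), ((liouvilleNumber b : ℝ) : ℂ) ^ 2] ∧
      LinLiouville ![((liouvilleNumber b : ℝ) : ℂ), ((liouvilleNumber b : ℝ) : ℂ) ^ 2] ∧
      ¬ HyperLinLiouville ![((liouvilleNumber b : ℝ) : ℂ), ((liouvilleNumber b : ℝ) : ℂ) ^ 2] ∧
      TechnicalHypothesis ![((liouvilleNumber b : ℝ) : ℂ), ((liouvilleNumber b : ℝ) : ℂ) ^ 2] :=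
  have h := liouvilleNumber_sq_cell hb
  ⟨h.1, h.2.2.1, h.2.2.2, technicalHypothesis_liouvilleNumber_sq hb⟩

/-- … so the named first open cell is REDUCED to 3816: `SchanuelUnderTH ⟹ trdeg ℚ(ℓ_b, ℓ_b², e^{ℓ_b}, e^{ℓ_b²}) ≥ 2`
(3816 is open; nothing is decided here). -/
theorem sb_namedCell_of_underTH (hU : UnderTH) (hb : 2 ≤ b) :
    SB 2 ![((liouvilleNumber b : ℝ) : ℂ), ((liouvilleNumber b : ℝ) : ℂ) ^ 2] :=
  hU 2 _ (liouvilleNumber_sq_cell hb).1 (technicalHypothesis_liouvilleNumber_sq hb)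

/-- **The moment curves lie in the scope of the layer `F₀`**: ℚ-free, linearly Liouville (tree
`linLiouville_momentCurve`), NOT hyper-linearly-Liouville, and (T.H.). -/
theorem momentCurve_mem_thLayer_scope (hb : 2 ≤ b) {n : ℕ} (hn : 2 ≤ n) :
    LinearIndependent ℚ (zC b n) ∧ LinLiouville (zC b n) ∧ ¬ HyperLinLiouville (zC b n) ∧
      TechnicalHypothesis (zC b n) :=
  ⟨linearIndependent_zC hb n, linLiouville_momentCurve (liouville_liouvilleNumber hb) hn,
    fun hH => not_technicalHypothesis_of_hyperLinLiouville hH (technicalHypothesis_zC hb n),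
    technicalHypothesis_zC hb n⟩

/-- The moment curves are INVISIBLE to the layer `F₊` (they satisfy (T.H.)). -/
theorem momentCurve_not_posLayer_input (hb : 2 ≤ b) (n : ℕ) : ¬ ¬ TechnicalHypothesis (zC b n) :=
  fun h => h (technicalHypothesis_zC hb n)

/-- What 33364 demands on the moment curve (the item applied through its verbatim copy `Item33364`). -/
theorem sb_momentCurve_of_item (hF : Item33364) (hb : 2 ≤ b) {n : ℕ} (hn : 2 ≤ n) : SB n (zC b n) :=
  have h := momentCurve_mem_thLayer_scope hb hn
  hF n _ h.1 h.2.1 h.2.2.1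

/-- … already from the layer `F₀` alone … -/
theorem sb_momentCurve_of_thLayer (hT : THLayer) (hb : 2 ≤ b) {n : ℕ} (hn : 2 ≤ n) : SB n (zC b n) :=
  have h := momentCurve_mem_thLayer_scope hb hn
  hT n _ h.1 h.2.1 h.2.2.1 h.2.2.2

/-- … hence **every Liouville moment curve is REDUCED to 3816** (`SchanuelUnderTH ⟹ SB n (zC b n)`, all `n`;
3816 is open — nothing is decided here). -/
theorem sb_momentCurve_of_underTH (hU : UnderTH) (hb : 2 ≤ b) (n : ℕ) : SB n (zC b n) :=
  hU n _ (linearIndependent_zC hb n) (technicalHypothesis_zC hb n)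

/-- Separation from the block cells of the lineage: any two coordinates of the moment curve are
ALGEBRAICALLY DEPENDENT over ℚ (`(ℓ^{i+1})^{j+1} = (ℓ^{j+1})^{i+1}`), so no earlier cell built on a block of
algebraically independent Liouville coordinates (`MulIndep` radices, measured walls) contains it. -/
theorem zC_coords_algDependent (b n : ℕ) (i j : Fin n) :
    ¬ AlgebraicIndependent ℚ ![zC b n i, zC b n j] := by
  intro hai
  set P : MvPolynomial (Fin 2) ℚ :=
    MvPolynomial.X 0 ^ ((j : ℕ) + 1) - MvPolynomial.X 1 ^ ((i : ℕ) + 1) with hP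
  have hP0 : P ≠ 0 := by
    intro h0
    have h1 := congrArg (MvPolynomial.eval ![(2 : ℚ), 1]) h0
    simp only [hP, map_sub, map_pow, MvPolynomial.eval_X, Matrix.cons_val_zero, Matrix.cons_val_one,
      map_zero, one_pow] at h1
    have h2 : (1 : ℚ) < 2 ^ ((j : ℕ) + 1) := one_lt_pow₀ (by norm_num) (by omega)
    linarith
  have heval : MvPolynomial.aeval ![zC b n i, zC b n j] P = 0 := by
    simp only [hP, map_sub, map_pow, MvPolynomial.aeval_X, Matrix.cons_val_zero, Matrix.cons_val_one,
      zC, ← pow_mul]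
    rw [sub_eq_zero, mul_comm]
  exact hP0 ((algebraicIndependent_iff_injective_aeval.mp hai) (heval.trans (map_zero _).symm))

end Powers

end Summit.Schanuel.Schanuel.Theorems.RootDecomp1KTHLayer

end
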